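import Literature.Geometry.Lorentzian.Basic
import Mathlib.Analysis.Calculus.InverseFunctionTheorem.ContDiff
import Mathlib.Analysis.InnerProductSpace.Projection.Reflection
import Mathlib.Analysis.InnerProductSpace.PiL2
import Mathlib.Analysis.Normed.Operator.BoundedLinearMaps
import Mathlib.Topology.Algebra.Module.FiniteDimension
import HarnessLib

/-!
# Crux `HawkingExtensionIsKerr` (stmt-FinalStateConjecture-17840), line `SketchIdeator2` —
# programme SEC, brick SEC-2a: the shear in `E4`

Helper file of the line lead (c7), registered sub-goal `stub_sec_shear`.

Programme SEC builds "K-charts" of the event horizon: coordinates in which a given vector field is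
`∂₀` and the horizon is `{x₁ = 0}`.  This file is the coordinate change in the model space
`E4 = EuclideanSpace ℝ (Fin 4)`, pure multivariable calculus (no manifolds):

* `stub_sec_shear` — given a `C^∞` function `f` on an open `S ∋ 0` with `f 0 = 0`, `df₀ ≠ 0`, and a
  vector `k ≠ 0` with `df₀ k = 0`, there are open sets `O₁ ∋ 0`, `O₂` (a ball, convex and stable
  under `z ↦ z - z₀ e₀`) and mutually inverse `C^∞` maps `Θ : O₁ → O₂`, `Θi : O₂ → O₁` with
  `Θ 0 = 0`, `dΘ_y k = e₀` on `O₁` (the constant field `k` is straightened to `e₀`), and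
  `(Θ y)₁ = f (Θi (Θ y - (Θ y)₀ e₀))` (on the slice `{z₀ = 0}` the coordinate `z₁` is `f ∘ Θi`).

Construction (the textbook "canonical form of a vector field near a regular point" argument, cf.
Lee, *Introduction to Smooth Manifolds*, 2nd ed., Thm 9.22, adapted to a hypersurface and carried
out in a fixed chart): a linear frame `A : E4 ≃L[ℝ] E4` with `A k = e₀` and `df₀ (A⁻¹ e₁) ≠ 0`
(a reflection, a dilation and a coordinate swap); the shear
`Φ z = z + (f (A⁻¹ (z - z₀ e₀)) - z₁) • e₁`, whose derivative `id + (dG - e₁^*) ⊗ e₁` is injective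
at `0`; the inverse function theorem (`ContDiffAt.toOpenPartialHomeomorph`) and
`OpenPartialHomeomorph.contDiffAt_symm` on a ball on whose preimage `fderiv Φ` stays invertible;
`Θ = Φ ∘ A`, `Θi = A⁻¹ ∘ Φ⁻¹`.  Everything used is Mathlib; `e₀ = EuclideanSpace.single 0 1`,
`e₁ = EuclideanSpace.single 1 1`.
-/

noncomputable section

set_option linter.dupNamespace false

namespace Summit.FinalStateConjecture.FinalStateConjecture.Theorems.HawkingExtensionIsKerr.SketchIdeator2

open Set Filter Bundle Function Literature.Geometry.Lorentzian
open scoped Manifold ContDiff Topology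

/-- Removing the `0`-th coordinate does not increase the Euclidean norm:
`‖z - z₀ e₀‖ ≤ ‖z‖` in `E4`. -/
private theorem secShear_norm_proj_le (z : E4) :
    ‖z - (z 0) • (EuclideanSpace.single 0 1 : E4)‖ ≤ ‖z‖ := by
  refine (sq_le_sq₀ (norm_nonneg _) (norm_nonneg _)).mp ?_
  rw [EuclideanSpace.real_norm_sq_eq, EuclideanSpace.real_norm_sq_eq]
  simp only [Fin.sum_univ_four, PiLp.sub_apply, PiLp.smul_apply, PiLp.single_apply]
  simp
  nlinarith [sq_nonneg (z 0)]

/-- Pointwise formula for the shear derivative `id + (φ - e₁^*) ⊗ e₁`: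
it sends `w` to `w + (φ w - w₁) • e₁`. -/
private theorem secShear_shearD_apply (φ : E4 →L[ℝ] ℝ) (w : E4) :
    (ContinuousLinearMap.id ℝ E4 + ContinuousLinearMap.smulRight
      (φ - (EuclideanSpace.proj (1 : Fin 4) : E4 →L[ℝ] ℝ)) (EuclideanSpace.single 1 1 : E4)) w =
      w + (φ w - w 1) • (EuclideanSpace.single 1 1 : E4) := rfl

/-- The shear derivative `id + (φ - e₁^*) ⊗ e₁` is injective as soon as `φ e₁ ≠ 0` (its matrix is
the identity except for row `1`, which is `(φ e₀, φ e₁, φ e₂, φ e₃)`). -/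
private theorem secShear_shearD_injective (φ : E4 →L[ℝ] ℝ)
    (hφ : φ (EuclideanSpace.single 1 1 : E4) ≠ 0) :
    Function.Injective (ContinuousLinearMap.id ℝ E4 + ContinuousLinearMap.smulRight
      (φ - (EuclideanSpace.proj (1 : Fin 4) : E4 →L[ℝ] ℝ)) (EuclideanSpace.single 1 1 : E4)) := by
  refine (injective_iff_map_eq_zero _).2 fun x hx => ?_
  have hc : ∀ i, (x + (φ x - x 1) • (EuclideanSpace.single 1 1 : E4)) i = 0 := fun i => by
    rw [← secShear_shearD_apply, hx]; rfl
  have h0 := hc 0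
  have h1 := hc 1
  have h2 := hc 2
  have h3 := hc 3
  simp at h0 h1 h2 h3
  have hx : x = (x 1) • (EuclideanSpace.single 1 1 : E4) := by
    ext i
    fin_cases i <;> simp [h0, h2, h3]
  have hφx : φ x = x 1 * φ (EuclideanSpace.single 1 1 : E4) := by
    conv_lhs => rw [hx]
    simp
  have hx1 : x 1 = 0 := by
    rcases mul_eq_zero.mp (hφx ▸ h1 : x 1 * φ (EuclideanSpace.single 1 1 : E4) = 0) with h | h
    · exact h
    · exact absurd h hφ
  rw [hx, hx1, zero_smul]

/-- An injective continuous linear endomorphism of `E4` is a continuous linear equivalence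
(finite dimension). -/
private theorem secShear_exists_equiv (D : E4 →L[ℝ] E4) (h : Function.Injective D) :
    ∃ L : E4 ≃L[ℝ] E4, (L : E4 →L[ℝ] E4) = D :=
  ⟨(LinearEquiv.ofInjectiveEndo D.toLinearMap h).toContinuousLinearEquiv, by ext1 x; rfl⟩

/-- Derivative of the shear: if `dG_z = G'` then `z ↦ z + (G z - z₁) • e₁` has derivative
`id + (G' - e₁^*) ⊗ e₁` at `z`. -/
private theorem secShear_hasFDerivAt_shear {G : E4 → ℝ} {G' : E4 →L[ℝ] ℝ} {z : E4}
    (hG : HasFDerivAt G G' z) :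
    HasFDerivAt (fun w : E4 => w + (G w - w 1) • (EuclideanSpace.single 1 1 : E4))
      (ContinuousLinearMap.id ℝ E4 + ContinuousLinearMap.smulRight
        (G' - (EuclideanSpace.proj (1 : Fin 4) : E4 →L[ℝ] ℝ)) (EuclideanSpace.single 1 1 : E4)) z :=
  (hasFDerivAt_id z).add
    ((hG.sub (EuclideanSpace.proj (1 : Fin 4) : E4 →L[ℝ] ℝ).hasFDerivAt).smul_const _)

/-- The shear commutes with the projection `pr : z ↦ z - z₀ e₀` when `G ∘ pr = G`:
`Φ (pr z) = pr (Φ z)` for `Φ z = z + (G z - z₁) • e₁`. -/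
private theorem secShear_shear_proj (pr : E4 →L[ℝ] E4)
    (hpr : ∀ z : E4, pr z = z - (z 0) • (EuclideanSpace.single 0 1 : E4)) (G : E4 → ℝ)
    (hG : ∀ z, G (pr z) = G z) (z : E4) :
    pr z + (G (pr z) - (pr z) 1) • (EuclideanSpace.single 1 1 : E4) =
      pr (z + (G z - z 1) • (EuclideanSpace.single 1 1 : E4)) := by
  rw [hG]
  simp only [hpr]
  ext i
  fin_cases i <;> simp

/-- A linear frame straightening `k ≠ 0` to `e₀`: `∃ A : E4 ≃L[ℝ] E4, A k = e₀` (the reflection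
exchanging `k/‖k‖` and `e₀`, `Submodule.reflection_sub`, followed by the dilation by `‖k‖⁻¹`). -/
private theorem secShear_exists_frame_aux (k : E4) (hk : k ≠ 0) :
    ∃ A : E4 ≃L[ℝ] E4, A k = (EuclideanSpace.single 0 1 : E4) := by
  have hk' : ‖k‖ ≠ 0 := norm_ne_zero_iff.mpr hk
  set v : E4 := ‖k‖⁻¹ • k with hv
  have hvn : ‖v‖ = ‖(EuclideanSpace.single 0 1 : E4)‖ := by
    rw [hv, norm_smul, norm_inv, norm_norm, inv_mul_cancel₀ hk', PiLp.norm_single, norm_one]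
  have hRv : (ℝ ∙ (v - EuclideanSpace.single 0 1))ᗮ.reflection v = EuclideanSpace.single 0 1 :=
    Submodule.reflection_sub hvn
  refine ⟨(ℝ ∙ (v - EuclideanSpace.single 0 1))ᗮ.reflection.toContinuousLinearEquiv.trans
    (LinearEquiv.smulOfNeZero ℝ E4 ‖k‖⁻¹ (inv_ne_zero hk')).toContinuousLinearEquiv, ?_⟩
  have hk2 : ‖k‖ • v = k := by rw [hv, smul_smul, mul_inv_cancel₀ hk', one_smul]
  have h3 : (ℝ ∙ (v - EuclideanSpace.single 0 1))ᗮ.reflection (‖k‖ • v) =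
      ‖k‖ • (EuclideanSpace.single 0 1 : E4) := by
    rw [map_smul, hRv]
  rw [hk2] at h3
  rw [ContinuousLinearEquiv.trans_apply]
  simp only [LinearIsometryEquiv.coe_toContinuousLinearEquiv,
    LinearEquiv.coe_toContinuousLinearEquiv', LinearEquiv.smulOfNeZero_apply]
  rw [h3, smul_smul, inv_mul_cancel₀ hk', one_smul]

/-- The adapted linear frame: for `k ≠ 0` and a covector `ℓ ≠ 0` with `ℓ k = 0` there is
`A : E4 ≃L[ℝ] E4` with `A k = e₀` and `ℓ (A⁻¹ e₁) ≠ 0` (the frame of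
`secShear_exists_frame_aux` followed by a coordinate swap `1 ↔ j`, where `ℓ (A₀⁻¹ e_j) ≠ 0` for
some `j ≠ 0` because `ℓ ∘ A₀⁻¹ ≠ 0` vanishes on `e₀`). -/
private theorem secShear_exists_frame (k : E4) (hk : k ≠ 0) (ℓ : E4 →L[ℝ] ℝ) (hℓk : ℓ k = 0)
    (hℓ : ℓ ≠ 0) :
    ∃ A : E4 ≃L[ℝ] E4, A k = (EuclideanSpace.single 0 1 : E4) ∧
      ℓ (A.symm (EuclideanSpace.single 1 1 : E4)) ≠ 0 := by
  obtain ⟨A₀, hA₀⟩ := secShear_exists_frame_aux k hk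
  have hA₀' : A₀.symm (EuclideanSpace.single 0 1 : E4) = k := by
    rw [← hA₀, A₀.symm_apply_apply]
  obtain ⟨j, hj0, hj⟩ : ∃ j : Fin 4, j ≠ 0 ∧ ℓ (A₀.symm (EuclideanSpace.single j 1)) ≠ 0 := by
    by_contra! hcon
    apply hℓ
    have h1 : ℓ.comp (A₀.symm : E4 →L[ℝ] E4) = 0 := by
      refine ContinuousLinearMap.coe_inj.mp
        ((EuclideanSpace.basisFun (Fin 4) ℝ).toBasis.ext fun i => ?_)
      rcases eq_or_ne i 0 with rfl | hi
      · simp [hA₀', hℓk]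
      · simp [hcon i hi]
    have h2 : ℓ = (ℓ.comp (A₀.symm : E4 →L[ℝ] E4)).comp (A₀ : E4 →L[ℝ] E4) := by
      ext x; simp
    rw [h2, h1, ContinuousLinearMap.zero_comp]
  set T : E4 ≃ₗᵢ[ℝ] E4 := LinearIsometryEquiv.piLpCongrLeft 2 ℝ ℝ (Equiv.swap (1 : Fin 4) j)
    with hT
  have hT0 : T (EuclideanSpace.single 0 1) = EuclideanSpace.single 0 1 := by
    rw [hT, LinearIsometryEquiv.piLpCongrLeft_single,
      Equiv.swap_apply_of_ne_of_ne (by decide) hj0.symm]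
  have hTj : T (EuclideanSpace.single j 1) = EuclideanSpace.single 1 1 := by
    rw [hT, LinearIsometryEquiv.piLpCongrLeft_single, Equiv.swap_apply_right]
  have hTs : T.symm (EuclideanSpace.single 1 1) = EuclideanSpace.single j 1 :=
    T.injective (by rw [T.apply_symm_apply, hTj])
  refine ⟨A₀.trans T.toContinuousLinearEquiv, ?_, ?_⟩
  · rw [ContinuousLinearEquiv.trans_apply, hA₀]
    simpa using hT0
  · rw [ContinuousLinearEquiv.symm_trans_apply]
    have : T.toContinuousLinearEquiv.symm (EuclideanSpace.single 1 1) =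
        T.symm (EuclideanSpace.single 1 1) := rfl
    rw [this, hTs]
    exact hj

/-- **The shear in `E4`, with the adapted frame as data.**  For `f` of class `C^∞` on an open
`S ∋ 0` with `f 0 = 0` and a frame `A : E4 ≃L[ℝ] E4` with `A k = e₀`, `df₀ (A⁻¹ e₁) ≠ 0`:
with `pr z = z - z₀ e₀`, `G z = f (A⁻¹ (pr z))` and the shear `Φ z = z + (G z - z₁) • e₁` (so
`Φ 0 = 0`, `(Φ z)₁ = G z`, `Φ ∘ pr = pr ∘ Φ`, `dΦ e₀ = e₀`, `dΦ₀` injective), the inverse function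
theorem gives a local inverse `Φ⁻¹` near `0 = Φ 0`; on a small ball `O₂` around `0` (inside the
target, with `Φ⁻¹ (O₂)` inside the set where `Φ` is smooth with invertible derivative, inside
`A (S)` and inside `pr ⁻¹' (source)`) the maps `Θ = Φ ∘ A` on `O₁ = Θ ⁻¹' O₂` and `Θi = A⁻¹ ∘ Φ⁻¹`
on `O₂` have all the listed properties. -/
private theorem secShear_core (f : E4 → ℝ) (S : Set E4) (k : E4) (A : E4 ≃L[ℝ] E4)
    (hS : IsOpen S) (h0S : (0 : E4) ∈ S) (hf : ContDiffOn ℝ ∞ f S) (hf0 : f 0 = 0)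
    (hAk : A k = (EuclideanSpace.single 0 1 : E4))
    (hα : fderiv ℝ f 0 (A.symm (EuclideanSpace.single 1 1 : E4)) ≠ 0) :
    ∃ (O₁ O₂ : Set E4) (Θ Θi : E4 → E4), IsOpen O₁ ∧ IsOpen O₂ ∧ Convex ℝ O₂ ∧ (0 : E4) ∈ O₁ ∧
      O₁ ⊆ S ∧ Θ 0 = 0 ∧ (∀ y ∈ O₁, Θ y ∈ O₂ ∧ Θi (Θ y) = y) ∧
      (∀ z ∈ O₂, Θi z ∈ O₁ ∧ Θ (Θi z) = z) ∧ ContDiffOn ℝ ∞ Θ O₁ ∧ ContDiffOn ℝ ∞ Θi O₂ ∧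
      (∀ y ∈ O₁, fderiv ℝ Θ y k = EuclideanSpace.single 0 1) ∧
      (∀ z ∈ O₂, z - (z 0) • EuclideanSpace.single 0 1 ∈ O₂) ∧
      (∀ y ∈ O₁, (Θ y) 1 = f (Θi (Θ y - ((Θ y) 0) • EuclideanSpace.single 0 1))) := by
  -- the projection `pr` killing the coordinate `0`, as a continuous linear map
  obtain ⟨pr, hpr⟩ :
      ∃ pr : E4 →L[ℝ] E4, ∀ z : E4, pr z = z - (z 0) • (EuclideanSpace.single 0 1 : E4) :=
    ⟨ContinuousLinearMap.id ℝ E4 - ContinuousLinearMap.smulRight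
      (EuclideanSpace.proj (0 : Fin 4) : E4 →L[ℝ] ℝ) (EuclideanSpace.single 0 1 : E4), fun z => rfl⟩
  -- the pulled-back function `G`, the shear `Φ`, their derivatives `L z`, `M (L z)`
  set G : E4 → ℝ := fun z => f (A.symm (pr z)) with hGdef
  set Φ : E4 → E4 := fun z => z + (G z - z 1) • (EuclideanSpace.single 1 1 : E4) with hΦdef
  set L : E4 → E4 →L[ℝ] ℝ := fun z =>
    (fderiv ℝ f (A.symm (pr z))).comp ((A.symm : E4 →L[ℝ] E4).comp pr) with hLdef
  set M : (E4 →L[ℝ] ℝ) → E4 →L[ℝ] E4 := fun φ =>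
    ContinuousLinearMap.id ℝ E4 + ContinuousLinearMap.smulRight
      (φ - (EuclideanSpace.proj (1 : Fin 4) : E4 →L[ℝ] ℝ)) (EuclideanSpace.single 1 1 : E4)
    with hMdef
  set V : Set E4 := {z | A.symm (pr z) ∈ S}
  have hV : IsOpen V := hS.preimage (A.symm.continuous.comp pr.continuous)
  have h0V : (0 : E4) ∈ V := by
    rw [Set.mem_setOf_eq, map_zero, map_zero]
    exact h0S
  -- elementary identities
  have hprpr : ∀ z : E4, pr (pr z) = pr z := by
    intro z
    have h0 : (pr z) 0 = 0 := by rw [hpr]; simp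
    rw [hpr (pr z), h0, zero_smul, sub_zero]
  have hGpr : ∀ z, G (pr z) = G z := fun z => by simp only [hGdef, hprpr]
  have hΦpr : ∀ z, Φ (pr z) = pr (Φ z) := fun z => secShear_shear_proj pr hpr G hGpr z
  have hΦpr' : ∀ z : E4, Φ (z - (z 0) • (EuclideanSpace.single 0 1 : E4)) =
      Φ z - ((Φ z) 0) • (EuclideanSpace.single 0 1 : E4) := by
    intro z
    rw [← hpr, ← hpr]
    exact hΦpr z
  have hGap : ∀ z : E4, G z = f (A.symm (z - (z 0) • (EuclideanSpace.single 0 1 : E4))) :=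
    fun z => by simp only [hGdef, hpr]
  have hΦ1 : ∀ z, (Φ z) 1 = G z := fun z => by simp [hΦdef]
  have hG0 : G 0 = 0 := by simp [hGdef, hf0]
  have hΦ0 : Φ 0 = 0 := by simp [hΦdef, hG0]
  -- smoothness of `G` and `Φ` on `V`
  have hGs : ContDiffOn ℝ ∞ G V :=
    hf.comp ((A.symm : E4 →L[ℝ] E4).comp pr).contDiff.contDiffOn fun z hz => hz
  have hΦs : ContDiffOn ℝ ∞ Φ V :=
    contDiffOn_id.add ((hGs.sub
      (EuclideanSpace.proj (1 : Fin 4) : E4 →L[ℝ] ℝ).contDiff.contDiffOn).smul contDiffOn_const)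
  -- derivatives of `G` and `Φ`
  have hGd : ∀ z ∈ V, HasFDerivAt G (L z) z := by
    intro z hz
    have hfd : HasFDerivAt f (fderiv ℝ f (A.symm (pr z))) (A.symm (pr z)) :=
      ((hf.contDiffAt (hS.mem_nhds hz)).differentiableAt (by simp)).hasFDerivAt
    exact hfd.comp z ((A.symm : E4 →L[ℝ] E4).comp pr).hasFDerivAt
  have hΦd : ∀ z ∈ V, HasFDerivAt Φ (M (L z)) z :=
    fun z hz => secShear_hasFDerivAt_shear (hGd z hz)
  -- the derivative of `Φ` fixes `e₀`
  have hΦde₀ : ∀ z : E4, M (L z) (EuclideanSpace.single 0 1) = EuclideanSpace.single 0 1 := by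
    intro z
    simp [hMdef, hLdef, hpr]
  -- the derivative of `Φ` at `0` is invertible
  have hinj : Function.Injective (M (L 0)) := by
    apply secShear_shearD_injective
    simpa [hLdef, hpr] using hα
  obtain ⟨L0, hL0⟩ := secShear_exists_equiv _ hinj
  have hΦd0 : HasFDerivAt Φ (L0 : E4 →L[ℝ] E4) 0 := by rw [hL0]; exact hΦd 0 h0V
  have hΦc0 : ContDiffAt ℝ ∞ Φ 0 := hΦs.contDiffAt (hV.mem_nhds h0V)
  -- the inverse function theorem
  set P := hΦc0.toOpenPartialHomeomorph Φ hΦd0 (by simp)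
  have hPΦ : (P : E4 → E4) = Φ := rfl
  have h0src : (0 : E4) ∈ P.source := hΦc0.mem_toOpenPartialHomeomorph_source hΦd0 (by simp)
  have h0tgt : (0 : E4) ∈ P.target := by
    have h := hΦc0.image_mem_toOpenPartialHomeomorph_target hΦd0 (by simp)
    rwa [hΦ0] at h
  have hPl : ∀ x ∈ P.source, P.symm (Φ x) = x := fun x hx => by
    rw [← hPΦ]
    exact P.left_inv hx
  have hPr : ∀ z ∈ P.target, Φ (P.symm z) = z := fun z hz => by
    rw [← hPΦ]
    exact P.right_inv hz
  have hPs0 : P.symm 0 = 0 := by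
    have h := hPl 0 h0src
    rwa [hΦ0] at h
  -- the open set where `Φ` is smooth with invertible derivative
  set W : Set E4 := V ∩ fderiv ℝ Φ ⁻¹' (Set.range ((↑) : (E4 ≃L[ℝ] E4) → E4 →L[ℝ] E4))
  have hW : IsOpen W :=
    (hΦs.continuousOn_fderiv_of_isOpen hV (by simp)).isOpen_inter_preimage hV
      ContinuousLinearEquiv.isOpen
  have h0W : (0 : E4) ∈ W := ⟨h0V, L0, hΦd0.fderiv.symm⟩
  -- the good neighbourhood of `0` and the ball `O₂`
  set N : Set E4 := P.source ∩ W ∩ {z | A.symm z ∈ S} ∩ {z | pr z ∈ P.source}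
  have hN : IsOpen N :=
    ((P.open_source.inter hW).inter (hS.preimage A.symm.continuous)).inter
      (P.open_source.preimage pr.continuous)
  have h0N : (0 : E4) ∈ N := by
    refine ⟨⟨⟨h0src, h0W⟩, ?_⟩, ?_⟩
    · rw [Set.mem_setOf_eq, map_zero]
      exact h0S
    · rw [Set.mem_setOf_eq, map_zero]
      exact h0src
  obtain ⟨r, hr, hball⟩ : ∃ r > 0, Metric.ball (0 : E4) r ⊆ P.target ∩ P.symm ⁻¹' N :=
    Metric.isOpen_iff.mp (P.isOpen_inter_preimage_symm hN) 0
      ⟨h0tgt, Set.mem_preimage.2 (by rw [hPs0]; exact h0N)⟩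
  -- `O₁ := A ⁻¹' (source ∩ Φ ⁻¹' O₂)` and what membership in it gives
  set O₁ : Set E4 := A ⁻¹' (P.source ∩ P ⁻¹' Metric.ball (0 : E4) r)
  have key : ∀ y ∈ O₁, A y ∈ P.source ∧ Φ (A y) ∈ Metric.ball (0 : E4) r ∧ A y ∈ N := by
    intro y hy
    have hy1 : A y ∈ P.source := hy.1
    have hy2 : Φ (A y) ∈ Metric.ball (0 : E4) r := by
      have h := Set.mem_preimage.1 hy.2
      rwa [hPΦ] at h
    refine ⟨hy1, hy2, ?_⟩
    have h := Set.mem_preimage.1 (hball hy2).2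
    rwa [hPl _ hy1] at h
  refine ⟨O₁, Metric.ball 0 r, Φ ∘ A, A.symm ∘ P.symm, ?_, Metric.isOpen_ball, convex_ball 0 r,
    ?_, ?_, ?_, ?_, ?_, ?_, ?_, ?_, ?_, ?_⟩
  · exact (P.isOpen_inter_preimage Metric.isOpen_ball).preimage A.continuous
  · rw [Set.mem_preimage, map_zero, Set.mem_inter_iff, Set.mem_preimage, hPΦ, hΦ0]
    exact ⟨h0src, Metric.mem_ball_self hr⟩
  · intro y hy
    simpa using (key y hy).2.2.1.2
  · rw [Function.comp_apply, map_zero, hΦ0]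
  · intro y hy
    obtain ⟨hy1, hy2, -⟩ := key y hy
    refine ⟨hy2, ?_⟩
    simp only [Function.comp_apply]
    rw [hPl _ hy1, A.symm_apply_apply]
  · intro z hz
    have hzT : z ∈ P.target := (hball hz).1
    refine ⟨?_, ?_⟩
    · rw [Function.comp_apply, Set.mem_preimage, A.apply_symm_apply]
      exact ⟨P.map_target hzT, Set.mem_preimage.2 (by rw [P.right_inv hzT]; exact hz)⟩
    · simp only [Function.comp_apply]
      rw [A.apply_symm_apply, hPr z hzT]
  · exact hΦs.comp A.contDiff.contDiffOn fun y hy => (key y hy).2.2.1.1.2.1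
  · intro z hz
    have hzT : z ∈ P.target := (hball hz).1
    have hNz : P.symm z ∈ N := Set.mem_preimage.1 (hball hz).2
    have hVz : P.symm z ∈ V := hNz.1.1.2.1
    obtain ⟨e, he⟩ := Set.mem_preimage.1 hNz.1.1.2.2
    have hd : HasFDerivAt P (e : E4 →L[ℝ] E4) (P.symm z) := by
      rw [he, hPΦ]
      exact (hΦd _ hVz).differentiableAt.hasFDerivAt
    have hsm : ContDiffAt ℝ ∞ P (P.symm z) := by
      rw [hPΦ]
      exact hΦs.contDiffAt (hV.mem_nhds hVz)
    exact (A.symm.contDiff.contDiffAt.comp z (P.contDiffAt_symm hzT hd hsm)).contDiffWithinAt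
  · intro y hy
    have hVy : A y ∈ V := (key y hy).2.2.1.1.2.1
    have hAk' : (A : E4 →L[ℝ] E4) k = EuclideanSpace.single 0 1 := hAk
    rw [((hΦd (A y) hVy).comp y A.hasFDerivAt).fderiv, ContinuousLinearMap.comp_apply, hAk']
    exact hΦde₀ (A y)
  · intro z hz
    have h := secShear_norm_proj_le z
    rw [Metric.mem_ball, dist_zero_right] at hz ⊢
    exact lt_of_le_of_lt h hz
  · intro y hy
    obtain ⟨-, -, hyN⟩ := key y hy
    have hprs : A y - ((A y) 0) • (EuclideanSpace.single 0 1 : E4) ∈ P.source := by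
      have h := hyN.2
      rw [Set.mem_setOf_eq, hpr] at h
      exact h
    simp only [Function.comp_apply]
    rw [← hΦpr' (A y), hPl _ hprs, hΦ1, hGap]

/-- **SEC-2a (the shear in `E4`; registered sub-goal `stub_sec_shear` of line SketchIdeator2).**
Let `f : E4 → ℝ` be `C^∞` on an open `S ∋ 0` with `f 0 = 0` and `df₀ ≠ 0`, and let `k ≠ 0` with
`df₀ k = 0` (in programme SEC: `f` is the horizon-defining function read in a flow-box chart and
`k` the constant coordinate expression of the vector field).  Then there are open `O₁ ∋ 0`,
`O₁ ⊆ S`, an open convex `O₂` stable under `z ↦ z - z₀ e₀`, and mutually inverse `C^∞` maps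
`Θ : O₁ → O₂`, `Θi : O₂ → O₁` with `Θ 0 = 0`, `fderiv Θ y k = e₀` for all `y ∈ O₁`, and
`(Θ y)₁ = f (Θi (Θ y - (Θ y)₀ e₀))` for all `y ∈ O₁`.  Proof: `secShear_exists_frame` (a linear
frame `A` with `A k = e₀`, `df₀ (A⁻¹ e₁) ≠ 0`) and `secShear_core` (shear + inverse function
theorem). -/
theorem stub_sec_shear : ∀ (f : E4 → ℝ) (S : Set E4) (k : E4), IsOpen S → (0 : E4) ∈ S →
    ContDiffOn ℝ ∞ f S → f 0 = 0 → k ≠ 0 → fderiv ℝ f 0 k = 0 → fderiv ℝ f 0 ≠ 0 →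
    ∃ (O₁ O₂ : Set E4) (Θ Θi : E4 → E4), IsOpen O₁ ∧ IsOpen O₂ ∧ Convex ℝ O₂ ∧ (0 : E4) ∈ O₁ ∧
    O₁ ⊆ S ∧ Θ 0 = 0 ∧ (∀ y ∈ O₁, Θ y ∈ O₂ ∧ Θi (Θ y) = y) ∧ (∀ z ∈ O₂, Θi z ∈ O₁ ∧ Θ (Θi z) = z) ∧
    ContDiffOn ℝ ∞ Θ O₁ ∧ ContDiffOn ℝ ∞ Θi O₂ ∧
    (∀ y ∈ O₁, fderiv ℝ Θ y k = EuclideanSpace.single 0 1) ∧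
    (∀ z ∈ O₂, z - (z 0) • EuclideanSpace.single 0 1 ∈ O₂) ∧
    (∀ y ∈ O₁, (Θ y) 1 = f (Θi (Θ y - ((Θ y) 0) • EuclideanSpace.single 0 1))) := by
  intro f S k hS h0S hf hf0 hk hfk hfne
  obtain ⟨A, hAk, hα⟩ := secShear_exists_frame k hk (fderiv ℝ f 0) hfk hfne
  exact secShear_core f S k A hS h0S hf hf0 hAk hα

end Summit.FinalStateConjecture.FinalStateConjecture.Theorems.HawkingExtensionIsKerr.SketchIdeator2

end
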